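import Literature.Analysis.FunctionSpaces.LiebWuEnergyHalfFillingEnclosureU4
import Mathlib.Analysis.SpecialFunctions.ImproperIntegrals
import Mathlib.Analysis.SpecialFunctions.Trigonometric.Series
import Mathlib.Analysis.SpecialFunctions.Integrals.Basic
import Mathlib.MeasureTheory.Integral.Prod
import HarnessLib

/-!
# The Laplace transform of `J₀J₁/ω` in closed form for EVERY `c > 0`, and kernel-checked values inside the circle

Family `hubbard` (STEP-0 rung (i) of `hubbard-alg`: the half-filled Lieb–Wu energy
`e(U) = liebWuEnergy U = -4 ∫₀^∞ J₀J₁ dω/(ω(1 + e^{ωU/2}))`, PRL 20 (1968) 1445 eq. (20), BY NAME).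
Takahashi's route (`LiebWuEnergyStrongCouplingSeries`, Steps 1–3) writes `e(U)` through the Laplace terms
`I_c = ∫₀^∞ e^{-cω} g(ω) dω`, `g = J₀J₁/ω - 1/2` (`besselJ01Sub`), at `c = nU/2`, and evaluates each `I_c` by
integrating the product series of `J₀J₁/ω` term by term — which is legitimate only for `c > 2`
(`BesselJZeroOneProduct`: `J₀J₁` has exponential type `2`). Hence the tree's enclosures of `e(U)` stop at `U > 4`
(`LiebWuEnergyHalfFillingEnclosure{,Table}`) and `U = 4` (`…U4`, the boundary term `c = 2` by convexity).
This file removes the restriction `c > 2`: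

* `besselJ_zero_mul_one_div_eq_integral` — the PRODUCT FORMULA
  `J₀(ω)J₁(ω)/ω = (2/π²) ∫₀^π∫₀^π sin²θ cos²ψ cos(2ω sinθ sinψ) dψ dθ` (all `ω ≠ 0`): Watson §5.43 (1)
  `J₀J₁(ω) = (2/π)∫₀^{π/2} J₁(2ω cos θ) cos θ dθ` with Poisson's integral for `J₁` inserted; proved here as Watson
  proves §5.43 — from the product series §5.41 (1) (`hasSum_besselJ_zero_mul_one_div`) term by term, the
  trigonometric moments being Wallis' integrals `W_m = ∫₀^π sin^{2m}` (Mathlib `integral_sin_pow`):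
  `γ_m = 4^m W_m W_{m+1}/(π²(m+1))` (`four_pow_mul_wallisSinIntegral_mul_succ`, by the recurrence
  `γ_{m+1}(m+2)² = γ_m(2m+1)(2m+3)` of `…EnclosureU4`), dominated convergence with bound `cosh 2ω`.
* `integral_exp_neg_mul_besselJ_zero_mul_one_div_eq_integral` — for EVERY `c > 0`,
  `∫₀^∞ e^{-cω} J₀J₁/ω dω = (2/π²) ∫₀^π∫₀^π sin²θ cos²ψ · c/(c² + 4 sin²θ sin²ψ) dψ dθ`
  (Fubini; `∫₀^∞ e^{-cω} cos(aω) dω = c/(c² + a²)`). (Integrating `ψ` out gives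
  `(1/2π)∫₀^π √(c² + 4 sin²θ) dθ - c/2 = √(c²+4) E(2/√(c²+4))/π - c/2`, the elliptic closed form used by the
  programme's interval code "method B"; not needed here.) `integral_exp_neg_mul_besselJ01Sub_eq_integral` is the
  same for `I_c` (subtract `1/(2c)`).
* `integral_exp_neg_mul_besselJ_zero_mul_one_div_mem_Icc` — expanding `c/(A + y)`, `A = c² + 2`,
  `y = 4 sin²θ sin²ψ - 2 ∈ [-2, 2]`, to `K` terms (finite geometric identity, EVEN `K`):
  `0 ≤ ∫₀^∞ e^{-cω} J₀J₁/ω - c Σ_{k<K} (-1)^k M_k/A^{k+1} ≤ M_K/(c A^K)`, where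
  `M_k = Σ_j C(k,j)(-2)^{k-j} γ_j` (`besselJ01CentredMoment`; the power moments of `4 sin²θ sin²ψ` against
  `(2/π²) sin²θ cos²ψ` are exactly the `γ_j`). The rate is `(2/(c²+2))^K` for every `c > 0` — at `c = 2` it is
  `3^{-K}`, against the `1/N⁵` of the boundary convexity trick of `…EnclosureU4`.
* Values (all from the tabulated `γ_0, …, γ_48`; `M_1, …, M_48` evaluated here):
  `integral_exp_neg_one_mul_besselJ01Sub_mem_Icc` — `I_1 ∈ [-0.161195014319, -0.161195014064]` (`K = 48`),
  `integral_exp_neg_three_halves_mul_besselJ01Sub_mem_Icc` — `I_{3/2} ∈ [-0.06764632049, -0.06764632048]`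
  (`K = 30`), `integral_exp_neg_two_mul_besselJ01Sub_mem_Icc'` — `I_2 ∈ [-0.0339932765751, -0.033993276575]`
  (`K = 26`, width `1e-13`; the convexity enclosure of `…EnclosureU4` has width `3.1e-9`).
  These are the `n = 1` Laplace terms of `e_LW(2)`, `e_LW(3)`, `e_LW(4)` (`LiebWuEnergyHalfFillingEnclosureU2U3`).

No named facts and no new definitions (the Wallis integrals `W_m = ∫₀^π sin^{2m}`, the kernel and the centred
moments `M_k` are written out in full); helper lemmas are proved here. `φ` is Mathlib notation (`Nat.totient`) under `open Nat`, so
the second angle is called `ψ`.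

## References

* G. N. Watson, *A Treatise on the Theory of Bessel Functions*, 2nd ed., CUP 1944, §5.41 eq. (1), §5.43 eq. (1)
  (held copy `book:watsonnd-treatise-theory-bessel-functions`, PDF p. 144) (key `Watson1944`).
* J. Oitmaa, C. Hamer, W. Zheng, CUP 2006, §8.2.1 eqs. (8.5)–(8.7) (key `OitmaaHamerZheng2006`).
* E. H. Lieb, F. Y. Wu, PRL 20 (1968) 1445, eq. (20) (key `LiebWuPRL1968`).
-/

noncomputable section

open Filter Set Real Nat MeasureTheory Finset intervalIntegral
open scoped Topology

namespace Literature.Analysis.FunctionSpaces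

/-! ## Wallis integrals `W_m = ∫₀^π sin^{2m}` and the moments `γ_m` -/


/-- `W_0 = π`. [cite: Watson1944, §5.43] -/
theorem wallisSinIntegral_zero : (∫ x in (0 : ℝ)..π, Real.sin x ^ (2 * 0)) = π := by
  simp

/-- Wallis' recurrence `W_{m+1} = (2m+1)/(2m+2) W_m` (Mathlib `integral_sin_pow`). [cite: Watson1944, §5.43] -/
theorem wallisSinIntegral_succ (m : ℕ) :
    (∫ x in (0 : ℝ)..π, Real.sin x ^ (2 * (m + 1))) = (2 * (m : ℝ) + 1) / (2 * (m : ℝ) + 2) * (∫ x in (0 : ℝ)..π, Real.sin x ^ (2 * m)) := by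
  rw [show 2 * (m + 1) = 2 * m + 2 by ring, integral_sin_pow]
  simp only [Real.sin_zero, Real.sin_pi, ne_eq, Nat.add_eq_zero_iff, one_ne_zero, and_false,
    not_false_eq_true, zero_pow, zero_mul, sub_self, zero_div, zero_add]
  push_cast
  ring

/-- `W_m > 0`. [cite: Watson1944, §5.43] -/
theorem wallisSinIntegral_pos (m : ℕ) : 0 < (∫ x in (0 : ℝ)..π, Real.sin x ^ (2 * m)) := by
  induction m with
  | zero => rw [wallisSinIntegral_zero]; exact Real.pi_pos
  | succ k ih => rw [wallisSinIntegral_succ]; positivity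

/-- **`4^m W_m W_{m+1} = π² (m+1) γ_m`** — the Laplace moments `γ_m` of `BesselJZeroOneProduct` are products of two
Wallis integrals (induction on the recurrences `γ_{m+1}(m+2)² = γ_m(2m+1)(2m+3)` and `W_{m+1} = (2m+1)/(2m+2) W_m`).
[cite: Watson1944, §5.43] -/
theorem four_pow_mul_wallisSinIntegral_mul_succ (m : ℕ) :
    4 ^ m * (∫ x in (0 : ℝ)..π, Real.sin x ^ (2 * m)) * (∫ x in (0 : ℝ)..π, Real.sin x ^ (2 * (m + 1))) = π ^ 2 * ((m : ℝ) + 1) * besselJ01Moment m := by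
  induction m with
  | zero =>
    rw [wallisSinIntegral_succ, wallisSinIntegral_zero, besselJ01Moment_zero]
    push_cast
    ring
  | succ k ih =>
    have hrec := besselJ01Moment_succ_mul_sq k
    have hW1 := wallisSinIntegral_succ k
    have hW2 := wallisSinIntegral_succ (k + 1)
    push_cast at hW2 ⊢
    have hk2 : ((k : ℝ) + 2) ^ 2 ≠ 0 := by positivity
    -- γ_{k+1} = γ_k (2k+1)(2k+3)/(k+2)²
    have hγ : besselJ01Moment (k + 1) = besselJ01Moment k * ((2 * (k : ℝ) + 1) * (2 * (k : ℝ) + 3)) /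
        ((k : ℝ) + 2) ^ 2 := by
      rw [eq_div_iff hk2]; exact hrec
    rw [hW2, hγ, pow_succ]
    have hk1 : (2 * (k : ℝ) + 2) ≠ 0 := by positivity
    have hk3 : (2 * ((k : ℝ) + 1) + 2) ≠ 0 := by positivity
    -- use ih: 4^k W_k W_{k+1} = π²(k+1)γ_k, and W_{k+1} = (2k+1)/(2k+2) W_k
    have e1 : 4 ^ k * 4 * (∫ x in (0 : ℝ)..π, Real.sin x ^ (2 * (k + 1))) *
        ((2 * ((k : ℝ) + 1) + 1) / (2 * ((k : ℝ) + 1) + 2) * (∫ x in (0 : ℝ)..π, Real.sin x ^ (2 * (k + 1)))) =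
        (4 ^ k * (∫ x in (0 : ℝ)..π, Real.sin x ^ (2 * k)) * (∫ x in (0 : ℝ)..π, Real.sin x ^ (2 * (k + 1)))) *
          (4 * (2 * (k : ℝ) + 3) * (2 * (k : ℝ) + 1) / ((2 * (k : ℝ) + 4) * (2 * (k : ℝ) + 2))) := by
      rw [hW1]
      field_simp
      ring
    rw [e1, ih]
    field_simp
    ring

/-- `∫₀^π sin^{2m} ψ cos² ψ dψ = W_m - W_{m+1}`. [cite: Watson1944, §5.43] -/
theorem integral_sin_pow_even_mul_cos_sq_eq_wallis (m : ℕ) :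
    ∫ x in (0 : ℝ)..π, Real.sin x ^ (2 * m) * Real.cos x ^ 2 = (∫ x in (0 : ℝ)..π, Real.sin x ^ (2 * m)) - (∫ x in (0 : ℝ)..π, Real.sin x ^ (2 * (m + 1))) := by
  rw [← intervalIntegral.integral_sub (by apply Continuous.intervalIntegrable; fun_prop)
    (by apply Continuous.intervalIntegrable; fun_prop)]
  refine intervalIntegral.integral_congr fun x _ => ?_
  rw [show 2 * (m + 1) = 2 * m + 2 by ring, pow_add, Real.cos_sq']
  ring

/-- The coefficient identity behind the product formula:
`(2/π²) (2^{2m}/(2m)!) W_{m+1} (W_m - W_{m+1}) = β_m/2^{2m+1}` (`β_m = besselJ01Coeff m`). [cite: Watson1944, §5.43] -/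
theorem besselJ01Coeff_div_eq_wallis (m : ℕ) :
    2 / π ^ 2 * ((2 : ℝ) ^ (2 * m) / ((2 * m)! : ℝ)) *
        ((∫ x in (0 : ℝ)..π, Real.sin x ^ (2 * (m + 1))) * ((∫ x in (0 : ℝ)..π, Real.sin x ^ (2 * m)) - (∫ x in (0 : ℝ)..π, Real.sin x ^ (2 * (m + 1))))) =
      besselJ01Coeff m / 2 ^ (2 * m + 1) := by
  have hA := four_pow_mul_wallisSinIntegral_mul_succ m
  have hW1 := wallisSinIntegral_succ m
  have hπ : π ^ 2 ≠ 0 := by positivity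
  have hf : ((2 * m)! : ℝ) ≠ 0 := by positivity
  have hm : (2 * (m : ℝ) + 2) ≠ 0 := by positivity
  -- W_m - W_{m+1} = W_m/(2m+2)
  have hdiff : (∫ x in (0 : ℝ)..π, Real.sin x ^ (2 * m)) - (∫ x in (0 : ℝ)..π, Real.sin x ^ (2 * (m + 1))) = (∫ x in (0 : ℝ)..π, Real.sin x ^ (2 * m)) / (2 * (m : ℝ) + 2) := by
    rw [hW1]; field_simp; ring
  rw [hdiff]
  -- γ_m = β_m (2m)!/2^{2m+1}
  have hγ : besselJ01Coeff m = besselJ01Moment m * 2 ^ (2 * m + 1) / ((2 * m)! : ℝ) := by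
    unfold besselJ01Moment; field_simp
  rw [hγ]
  have h4 : (2 : ℝ) ^ (2 * m) = 4 ^ m := by rw [pow_mul]; norm_num
  rw [h4]
  have e : 2 / π ^ 2 * (4 ^ m / ((2 * m)! : ℝ)) * ((∫ x in (0 : ℝ)..π, Real.sin x ^ (2 * (m + 1))) * ((∫ x in (0 : ℝ)..π, Real.sin x ^ (2 * m)) / (2 * (m : ℝ) + 2)))
      = (4 ^ m * (∫ x in (0 : ℝ)..π, Real.sin x ^ (2 * m)) * (∫ x in (0 : ℝ)..π, Real.sin x ^ (2 * (m + 1)))) / (π ^ 2 * ((2 * m)! : ℝ) * ((m : ℝ) + 1)) := by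
    field_simp
  rw [e, hA]
  field_simp

/-! ## The product formula `J₀(ω)J₁(ω)/ω = (2/π²) ∫₀^π∫₀^π sin²θ cos²ψ cos(2ω sinθ sinψ) dψ dθ` -/



/-- The cosine series of the kernel. [cite: Watson1944, §5.43] -/
theorem hasSum_besselJ01ProductKernelTerm (ω θ ψ : ℝ) :
    HasSum (fun m => (Real.sin θ ^ 2 * Real.cos ψ ^ 2 * ((-1 : ℝ) ^ m * (2 * ω * Real.sin θ * Real.sin ψ) ^ (2 * m) / ((2 * m)! : ℝ)))) ((Real.sin θ ^ 2 * Real.cos ψ ^ 2 * Real.cos (2 * ω * Real.sin θ * Real.sin ψ))) := by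
  exact (Real.hasSum_cos _).mul_left _

/-- Domination `|term_m| ≤ (2|ω|)^{2m}/(2m)!` (summing to `cosh 2|ω|`). [cite: Watson1944, §5.43] -/
theorem abs_besselJ01ProductKernelTerm_le (ω θ ψ : ℝ) (m : ℕ) :
    |(Real.sin θ ^ 2 * Real.cos ψ ^ 2 * ((-1 : ℝ) ^ m * (2 * ω * Real.sin θ * Real.sin ψ) ^ (2 * m) / ((2 * m)! : ℝ)))| ≤ (2 * |ω|) ^ (2 * m) / ((2 * m)! : ℝ) := by
  have hs : |Real.sin θ| ≤ 1 := Real.abs_sin_le_one θ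
  have hc : |Real.cos ψ| ≤ 1 := Real.abs_cos_le_one ψ
  have hs' : |Real.sin ψ| ≤ 1 := Real.abs_sin_le_one ψ
  have hx : |2 * ω * Real.sin θ * Real.sin ψ| ≤ 2 * |ω| := by
    rw [abs_mul, abs_mul, abs_mul, abs_two]
    calc 2 * |ω| * |Real.sin θ| * |Real.sin ψ| ≤ 2 * |ω| * 1 * 1 := by gcongr
      _ = 2 * |ω| := by ring
  have h1 : |Real.sin θ ^ 2 * Real.cos ψ ^ 2| ≤ 1 := by
    rw [abs_mul, abs_pow, abs_pow]
    calc |Real.sin θ| ^ 2 * |Real.cos ψ| ^ 2 ≤ 1 ^ 2 * 1 ^ 2 := by gcongr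
      _ = 1 := by norm_num
  have h2 : |(2 * ω * Real.sin θ * Real.sin ψ) ^ (2 * m)| ≤ (2 * |ω|) ^ (2 * m) := by
    rw [abs_pow]; exact pow_le_pow_left₀ (abs_nonneg _) hx _
  have h3 : |((-1 : ℝ) ^ m * (2 * ω * Real.sin θ * Real.sin ψ) ^ (2 * m) / ((2 * m)! : ℝ))| ≤
      (2 * |ω|) ^ (2 * m) / ((2 * m)! : ℝ) := by
    rw [abs_div, abs_mul, abs_pow, abs_neg, abs_one, one_pow, one_mul, Nat.abs_cast]
    gcongr
  rw [abs_mul]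
  calc |Real.sin θ ^ 2 * Real.cos ψ ^ 2| *
        |((-1 : ℝ) ^ m * (2 * ω * Real.sin θ * Real.sin ψ) ^ (2 * m) / ((2 * m)! : ℝ))|
      ≤ 1 * ((2 * |ω|) ^ (2 * m) / ((2 * m)! : ℝ)) := by gcongr
    _ = (2 * |ω|) ^ (2 * m) / ((2 * m)! : ℝ) := one_mul _

/-- Inner exchange of sum and `ψ`-integral (dominated convergence, bound `cosh 2|ω|`) — Watson: "the change of the
order of summation and integration presents no serious difficulty". [cite: Watson1944, §5.43] -/
theorem hasSum_integral_besselJ01ProductKernelTerm (ω θ : ℝ) :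
    HasSum (fun m => ∫ ψ in (0 : ℝ)..π, (Real.sin θ ^ 2 * Real.cos ψ ^ 2 * ((-1 : ℝ) ^ m * (2 * ω * Real.sin θ * Real.sin ψ) ^ (2 * m) / ((2 * m)! : ℝ))))
      (∫ ψ in (0 : ℝ)..π, (Real.sin θ ^ 2 * Real.cos ψ ^ 2 * Real.cos (2 * ω * Real.sin θ * Real.sin ψ))) := by
  refine intervalIntegral.hasSum_integral_of_dominated_convergence
    (fun m _ => (2 * |ω|) ^ (2 * m) / ((2 * m)! : ℝ)) (fun m => ?_) (fun m => ?_) ?_ ?_ ?_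
  · exact Continuous.aestronglyMeasurable (by fun_prop)
  · exact Eventually.of_forall fun ψ _ => by
      rw [Real.norm_eq_abs]; exact abs_besselJ01ProductKernelTerm_le ω θ ψ m
  · exact Eventually.of_forall fun ψ _ => (Real.hasSum_cosh (2 * |ω|)).summable
  · exact intervalIntegrable_const
  · exact Eventually.of_forall fun ψ _ => hasSum_besselJ01ProductKernelTerm ω θ ψ

/-- Outer exchange of sum and `θ`-integral. [cite: Watson1944, §5.43] -/
theorem hasSum_integral_integral_besselJ01ProductKernelTerm (ω : ℝ) :
    HasSum (fun m => ∫ θ in (0 : ℝ)..π, ∫ ψ in (0 : ℝ)..π, (Real.sin θ ^ 2 * Real.cos ψ ^ 2 * ((-1 : ℝ) ^ m * (2 * ω * Real.sin θ * Real.sin ψ) ^ (2 * m) / ((2 * m)! : ℝ))))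
      (∫ θ in (0 : ℝ)..π, ∫ ψ in (0 : ℝ)..π, (Real.sin θ ^ 2 * Real.cos ψ ^ 2 * Real.cos (2 * ω * Real.sin θ * Real.sin ψ))) := by
  refine intervalIntegral.hasSum_integral_of_dominated_convergence
    (fun m _ => (2 * |ω|) ^ (2 * m) / ((2 * m)! : ℝ) * |π - 0|) (fun m => ?_) (fun m => ?_) ?_ ?_ ?_
  · have hc : Continuous fun p : ℝ × ℝ => (Real.sin p.1 ^ 2 * Real.cos p.2 ^ 2 * ((-1 : ℝ) ^ m * (2 * ω * Real.sin p.1 * Real.sin p.2) ^ (2 * m) / ((2 * m)! : ℝ))) := by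
      fun_prop
    exact (intervalIntegral.continuous_parametric_intervalIntegral_of_continuous' hc 0 π).aestronglyMeasurable
  · refine Eventually.of_forall fun θ _ => ?_
    exact intervalIntegral.norm_integral_le_of_norm_le_const fun ψ _ => by
      rw [Real.norm_eq_abs]; exact abs_besselJ01ProductKernelTerm_le ω θ ψ m
  · exact Eventually.of_forall fun θ _ => ((Real.hasSum_cosh (2 * |ω|)).summable.mul_right _)
  · exact intervalIntegrable_const
  · exact Eventually.of_forall fun θ _ => hasSum_integral_besselJ01ProductKernelTerm ω θ

/-- Term evaluation by Wallis' integrals: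
`∫₀^π∫₀^π term_m = (-1)^m (2ω)^{2m}/(2m)! · W_{m+1}(W_m - W_{m+1})`. [cite: Watson1944, §5.43] -/
theorem integral_integral_besselJ01ProductKernelTerm (ω : ℝ) (m : ℕ) :
    ∫ θ in (0 : ℝ)..π, ∫ ψ in (0 : ℝ)..π, (Real.sin θ ^ 2 * Real.cos ψ ^ 2 * ((-1 : ℝ) ^ m * (2 * ω * Real.sin θ * Real.sin ψ) ^ (2 * m) / ((2 * m)! : ℝ))) =
      (-1) ^ m * (2 * ω) ^ (2 * m) / ((2 * m)! : ℝ) *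
        ((∫ x in (0 : ℝ)..π, Real.sin x ^ (2 * (m + 1))) * ((∫ x in (0 : ℝ)..π, Real.sin x ^ (2 * m)) - (∫ x in (0 : ℝ)..π, Real.sin x ^ (2 * (m + 1))))) := by
  have hψ : ∀ θ, ∫ ψ in (0 : ℝ)..π, (Real.sin θ ^ 2 * Real.cos ψ ^ 2 * ((-1 : ℝ) ^ m * (2 * ω * Real.sin θ * Real.sin ψ) ^ (2 * m) / ((2 * m)! : ℝ))) =
      (-1) ^ m * (2 * ω) ^ (2 * m) / ((2 * m)! : ℝ) * Real.sin θ ^ (2 * (m + 1)) *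
        ((∫ x in (0 : ℝ)..π, Real.sin x ^ (2 * m)) - (∫ x in (0 : ℝ)..π, Real.sin x ^ (2 * (m + 1)))) := by
    intro θ
    rw [← integral_sin_pow_even_mul_cos_sq_eq_wallis, ← intervalIntegral.integral_const_mul]
    refine intervalIntegral.integral_congr fun ψ _ => ?_
    rw [show 2 * (m + 1) = 2 * m + 2 by ring, pow_add]
    simp only [mul_pow]
    ring
  simp_rw [hψ]
  rw [intervalIntegral.integral_mul_const, intervalIntegral.integral_const_mul]
  ring

/-- **The product formula as a power-series identity**: for every real `ω`,
`Σ_m (-1)^m β_m ω^{2m}/2^{2m+1} = (2/π²) ∫₀^π∫₀^π sin²θ cos²ψ cos(2ω sinθ sinψ) dψ dθ`. [cite: Watson1944, §5.43 eq. (1)] -/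
theorem hasSum_besselJ01Coeff_besselJ01ProductKernel (ω : ℝ) :
    HasSum (fun m => (-1) ^ m * besselJ01Coeff m / 2 ^ (2 * m + 1) * ω ^ (2 * m))
      (2 / π ^ 2 * ∫ θ in (0 : ℝ)..π, ∫ ψ in (0 : ℝ)..π, (Real.sin θ ^ 2 * Real.cos ψ ^ 2 * Real.cos (2 * ω * Real.sin θ * Real.sin ψ))) := by
  have h := (hasSum_integral_integral_besselJ01ProductKernelTerm ω).mul_left (2 / π ^ 2)
  have e : (fun m => 2 / π ^ 2 * ∫ θ in (0 : ℝ)..π, ∫ ψ in (0 : ℝ)..π, (Real.sin θ ^ 2 * Real.cos ψ ^ 2 * ((-1 : ℝ) ^ m * (2 * ω * Real.sin θ * Real.sin ψ) ^ (2 * m) / ((2 * m)! : ℝ)))) =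
      fun m => (-1) ^ m * besselJ01Coeff m / 2 ^ (2 * m + 1) * ω ^ (2 * m) := by
    funext m
    rw [integral_integral_besselJ01ProductKernelTerm, mul_pow]
    linear_combination ((-1 : ℝ) ^ m * ω ^ (2 * m)) * besselJ01Coeff_div_eq_wallis m
  rw [e] at h
  exact h

/-- **`J₀(ω) J₁(ω)/ω = (2/π²) ∫₀^π∫₀^π sin²θ cos²ψ cos(2ω sinθ sinψ) dψ dθ`** for `ω ≠ 0`
(a Neumann/Watson-type product integral: Watson §5.43 (1) `J₀J₁(ω) = (2/π)∫₀^{π/2} J₁(2ω cos θ) cos θ dθ`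
combined with Poisson's integral for `J₁`; proved here by comparing power series). [cite: Watson1944, §5.43 eq. (1)] -/
theorem besselJ_zero_mul_one_div_eq_integral {ω : ℝ} (hω : ω ≠ 0) :
    besselJ 0 ω * besselJ 1 ω / ω = 2 / π ^ 2 * ∫ θ in (0 : ℝ)..π, ∫ ψ in (0 : ℝ)..π, (Real.sin θ ^ 2 * Real.cos ψ ^ 2 * Real.cos (2 * ω * Real.sin θ * Real.sin ψ)) :=
  (hasSum_besselJ_zero_mul_one_div hω).unique (hasSum_besselJ01Coeff_besselJ01ProductKernel ω)

/-! ## The Laplace transform for every `c > 0` -/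

/-- `∫₀^∞ e^{-cω} cos(aω) dω = c/(c² + a²)` for `c > 0` (real part of `∫₀^∞ e^{(-c+ia)ω} dω = 1/(c - ia)`,
Mathlib `integral_exp_mul_complex_Ioi`). [folklore] -/
private theorem integral_exp_neg_mul_mul_cos_Ioi {c : ℝ} (hc : 0 < c) (a : ℝ) :
    ∫ ω in Ioi (0 : ℝ), Real.exp (-(c * ω)) * Real.cos (a * ω) = c / (c ^ 2 + a ^ 2) := by
  set z : ℂ := -(c : ℂ) + (a : ℂ) * Complex.I with hz
  have hzre : z.re = -c := by simp [hz]
  have hzim : z.im = a := by simp [hz]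
  have hzlt : z.re < 0 := by rw [hzre]; linarith
  have hre : ∀ ω : ℝ, RCLike.re (Complex.exp (z * (ω : ℂ))) = Real.exp (-(c * ω)) * Real.cos (a * ω) := by
    intro ω
    rw [RCLike.re_to_complex, Complex.exp_re]
    simp [Complex.mul_re, Complex.mul_im, hzre, hzim, neg_mul]
  have hint := integrableOn_exp_mul_complex_Ioi hzlt 0
  have hI := integral_exp_mul_complex_Ioi hzlt 0
  have h1 : ∫ ω in Ioi (0 : ℝ), Real.exp (-(c * ω)) * Real.cos (a * ω) =
      RCLike.re (∫ ω in Ioi (0 : ℝ), Complex.exp (z * (ω : ℂ))) := by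
    rw [← integral_re hint]
    exact setIntegral_congr_fun measurableSet_Ioi (fun ω _ => (hre ω).symm)
  rw [h1, hI, RCLike.re_to_complex]
  have hnorm : Complex.normSq z = c ^ 2 + a ^ 2 := by
    rw [Complex.normSq_apply, hzre, hzim]; ring
  simp only [Complex.ofReal_zero, mul_zero, Complex.exp_zero]
  rw [Complex.div_re, Complex.neg_re, Complex.neg_im, Complex.one_re, Complex.one_im, hzre, hzim, hnorm]
  ring

/-- `|K| ≤ 1`. [cite: Watson1944, §5.43] -/
theorem abs_besselJ01ProductKernel_le_one (ω θ ψ : ℝ) : |(Real.sin θ ^ 2 * Real.cos ψ ^ 2 * Real.cos (2 * ω * Real.sin θ * Real.sin ψ))| ≤ 1 := by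
  rw [abs_mul, abs_mul, abs_pow, abs_pow]
  have h1 := Real.abs_sin_le_one θ
  have h2 := Real.abs_cos_le_one ψ
  have h3 := Real.abs_cos_le_one (2 * ω * Real.sin θ * Real.sin ψ)
  calc |Real.sin θ| ^ 2 * |Real.cos ψ| ^ 2 * |Real.cos (2 * ω * Real.sin θ * Real.sin ψ)|
      ≤ 1 ^ 2 * 1 ^ 2 * 1 := by gcongr
    _ = 1 := by norm_num

/-- The `ω`-integral: `∫₀^∞ e^{-cω} sin²θ cos²ψ cos(2ω sinθ sinψ) dω = sin²θ cos²ψ · c/(c² + 4 sin²θ sin²ψ)`.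
[cite: OitmaaHamerZheng2006, §8.2.1 eq. (8.5)] -/
theorem integral_exp_neg_mul_besselJ01ProductKernel {c : ℝ} (hc : 0 < c) (θ ψ : ℝ) :
    ∫ ω in Ioi (0 : ℝ), Real.exp (-(c * ω)) * (Real.sin θ ^ 2 * Real.cos ψ ^ 2 * Real.cos (2 * ω * Real.sin θ * Real.sin ψ)) =
      Real.sin θ ^ 2 * Real.cos ψ ^ 2 * (c / (c ^ 2 + (2 * Real.sin θ * Real.sin ψ) ^ 2)) := by
  have e : (fun ω => Real.exp (-(c * ω)) * (Real.sin θ ^ 2 * Real.cos ψ ^ 2 * Real.cos (2 * ω * Real.sin θ * Real.sin ψ))) = fun ω =>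
      Real.sin θ ^ 2 * Real.cos ψ ^ 2 * (Real.exp (-(c * ω)) * Real.cos ((2 * Real.sin θ * Real.sin ψ) * ω)) := by
    funext ω
    rw [show 2 * ω * Real.sin θ * Real.sin ψ = (2 * Real.sin θ * Real.sin ψ) * ω by ring]
    ring
  rw [e, MeasureTheory.integral_const_mul, integral_exp_neg_mul_mul_cos_Ioi hc]

/-- `e^{-cω}` is integrable on `(0, ∞)` (Mathlib `exp_neg_integrableOn_Ioi`, reshaped). [folklore] -/
private theorem integrable_exp_neg_Ioi' {c : ℝ} (hc : 0 < c) :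
    Integrable (fun ω => Real.exp (-(c * ω))) (volume.restrict (Ioi (0 : ℝ))) := by
  have h : IntegrableOn (fun ω => Real.exp (-c * ω)) (Ioi (0 : ℝ)) := exp_neg_integrableOn_Ioi 0 hc
  refine h.congr (Eventually.of_forall fun x => ?_)
  simp only [neg_mul]

/-- Integrability on `(0,∞) × (0,π]` of `(ω, ψ) ↦ e^{-cω} K(ω, θ, ψ)` (bound `e^{-cω}`).
[cite: OitmaaHamerZheng2006, §8.2.1 eq. (8.5)] -/
theorem integrable_exp_neg_mul_besselJ01ProductKernel_prod {c : ℝ} (hc : 0 < c) (θ : ℝ) :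
    Integrable (Function.uncurry fun ω ψ => Real.exp (-(c * ω)) * (Real.sin θ ^ 2 * Real.cos ψ ^ 2 * Real.cos (2 * ω * Real.sin θ * Real.sin ψ)))
      ((volume.restrict (Ioi (0 : ℝ))).prod (volume.restrict (Ioc (0 : ℝ) π))) := by
  haveI : IsFiniteMeasure (volume.restrict (Ioc (0 : ℝ) π)) :=
    isFiniteMeasure_restrict.2 measure_Ioc_lt_top.ne
  have hg : Integrable (fun p : ℝ × ℝ => Real.exp (-(c * p.1)) * (1 : ℝ))
      ((volume.restrict (Ioi (0 : ℝ))).prod (volume.restrict (Ioc (0 : ℝ) π))) :=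
    (integrable_exp_neg_Ioi' hc).mul_prod (integrable_const 1)
  refine hg.mono' ?_ (Eventually.of_forall fun p => ?_)
  · have hK : Continuous fun p : ℝ × ℝ => Real.exp (-(c * p.1)) * (Real.sin θ ^ 2 * Real.cos p.2 ^ 2 * Real.cos (2 * p.1 * Real.sin θ * Real.sin p.2)) := by
      fun_prop
    exact hK.aestronglyMeasurable
  · show ‖Real.exp (-(c * p.1)) * (Real.sin θ ^ 2 * Real.cos p.2 ^ 2 * Real.cos (2 * p.1 * Real.sin θ * Real.sin p.2))‖ ≤ Real.exp (-(c * p.1)) * 1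
    rw [Real.norm_eq_abs, abs_mul, abs_of_pos (Real.exp_pos _)]
    exact mul_le_mul_of_nonneg_left (abs_besselJ01ProductKernel_le_one _ _ _) (Real.exp_pos _).le

/-- Integrability on `(0,∞) × (0,π]` of `(ω, θ) ↦ ∫₀^π e^{-cω} K(ω, θ, ψ) dψ` (bound `π e^{-cω}`).
[cite: OitmaaHamerZheng2006, §8.2.1 eq. (8.5)] -/
theorem integrable_integral_exp_neg_mul_besselJ01ProductKernel_prod {c : ℝ} (hc : 0 < c) :
    Integrable (Function.uncurry fun ω θ => ∫ ψ in (0 : ℝ)..π, Real.exp (-(c * ω)) * (Real.sin θ ^ 2 * Real.cos ψ ^ 2 * Real.cos (2 * ω * Real.sin θ * Real.sin ψ)))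
      ((volume.restrict (Ioi (0 : ℝ))).prod (volume.restrict (Ioc (0 : ℝ) π))) := by
  haveI : IsFiniteMeasure (volume.restrict (Ioc (0 : ℝ) π)) :=
    isFiniteMeasure_restrict.2 measure_Ioc_lt_top.ne
  have hg : Integrable (fun p : ℝ × ℝ => π * Real.exp (-(c * p.1)) * (1 : ℝ))
      ((volume.restrict (Ioi (0 : ℝ))).prod (volume.restrict (Ioc (0 : ℝ) π))) :=
    ((integrable_exp_neg_Ioi' hc).const_mul π).mul_prod (integrable_const 1)
  refine hg.mono' ?_ (Eventually.of_forall fun p => ?_)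
  · have hK : Continuous (Function.uncurry fun (p : ℝ × ℝ) (ψ : ℝ) =>
        Real.exp (-(c * p.1)) * (Real.sin p.2 ^ 2 * Real.cos ψ ^ 2 * Real.cos (2 * p.1 * Real.sin p.2 * Real.sin ψ))) := by
      show Continuous fun q : (ℝ × ℝ) × ℝ => Real.exp (-(c * q.1.1)) * (Real.sin q.1.2 ^ 2 * Real.cos q.2 ^ 2 * Real.cos (2 * q.1.1 * Real.sin q.1.2 * Real.sin q.2))
      fun_prop
    exact (intervalIntegral.continuous_parametric_intervalIntegral_of_continuous' hK 0 π).aestronglyMeasurable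
  · show ‖∫ ψ in (0 : ℝ)..π, Real.exp (-(c * p.1)) * (Real.sin p.2 ^ 2 * Real.cos ψ ^ 2 * Real.cos (2 * p.1 * Real.sin p.2 * Real.sin ψ))‖ ≤ π * Real.exp (-(c * p.1)) * 1
    have h := intervalIntegral.norm_integral_le_of_norm_le_const (a := 0) (b := π)
      (f := fun ψ => Real.exp (-(c * p.1)) * (Real.sin p.2 ^ 2 * Real.cos ψ ^ 2 * Real.cos (2 * p.1 * Real.sin p.2 * Real.sin ψ))) (C := Real.exp (-(c * p.1)))
      (fun ψ _ => by
        rw [Real.norm_eq_abs, abs_mul, abs_of_pos (Real.exp_pos _)]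
        exact mul_le_of_le_one_right (Real.exp_pos _).le (abs_besselJ01ProductKernel_le_one _ _ _))
    rw [sub_zero, abs_of_pos Real.pi_pos] at h
    linarith

/-- **Laplace transform of `J₀J₁/ω` in closed form, for every `c > 0`**:
`∫₀^∞ e^{-cω} J₀(ω)J₁(ω) dω/ω = (2/π²) ∫₀^π∫₀^π sin²θ cos²ψ · c/(c² + 4 sin²θ sin²ψ) dψ dθ`
(`= √(c²+4) E(2/√(c²+4))/π - c/2`, an elliptic integral; Takahashi's term-by-term series
`Σ_m (-1)^m γ_m/c^{2m+1}` represents it only for `c > 2`). Product formula, Fubini, and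
`∫₀^∞ e^{-cω} cos(aω) dω = c/(c²+a²)`. [cite: OitmaaHamerZheng2006, §8.2.1 eq. (8.5)] -/
theorem integral_exp_neg_mul_besselJ_zero_mul_one_div_eq_integral {c : ℝ} (hc : 0 < c) :
    ∫ ω in Ioi (0 : ℝ), Real.exp (-(c * ω)) * (besselJ 0 ω * besselJ 1 ω / ω) =
      2 / π ^ 2 * ∫ θ in (0 : ℝ)..π, ∫ ψ in (0 : ℝ)..π,
        Real.sin θ ^ 2 * Real.cos ψ ^ 2 * (c / (c ^ 2 + (2 * Real.sin θ * Real.sin ψ) ^ 2)) := by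
  -- pointwise on `(0, ∞)`: the product formula, constants moved inside
  have hpt : ∀ ω ∈ Ioi (0 : ℝ), Real.exp (-(c * ω)) * (besselJ 0 ω * besselJ 1 ω / ω) =
      2 / π ^ 2 * ∫ θ in (0 : ℝ)..π, ∫ ψ in (0 : ℝ)..π, Real.exp (-(c * ω)) * (Real.sin θ ^ 2 * Real.cos ψ ^ 2 * Real.cos (2 * ω * Real.sin θ * Real.sin ψ)) := by
    intro ω hω
    rw [besselJ_zero_mul_one_div_eq_integral (ne_of_gt hω)]
    simp_rw [intervalIntegral.integral_const_mul]
    ring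
  rw [setIntegral_congr_fun measurableSet_Ioi hpt, MeasureTheory.integral_const_mul]
  congr 1
  -- interval integrals as integrals over `Ioc 0 π`
  simp_rw [intervalIntegral.integral_of_le Real.pi_pos.le]
  -- swap `ω` and `θ`
  have hsw1 := MeasureTheory.integral_integral_swap (integrable_integral_exp_neg_mul_besselJ01ProductKernel_prod hc)
  simp_rw [intervalIntegral.integral_of_le Real.pi_pos.le] at hsw1
  rw [hsw1]
  refine setIntegral_congr_fun measurableSet_Ioc fun θ _ => ?_
  -- swap `ω` and `ψ`
  have hsw2 := MeasureTheory.integral_integral_swap (integrable_exp_neg_mul_besselJ01ProductKernel_prod hc θ)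
  rw [hsw2]
  refine setIntegral_congr_fun measurableSet_Ioc fun ψ _ => ?_
  exact integral_exp_neg_mul_besselJ01ProductKernel hc θ ψ

/-- The same for Takahashi's subtracted Laplace term `I_c = ∫₀^∞ e^{-cω} g(ω) dω`, `g = J₀J₁/ω - 1/2`
(`besselJ01Sub`): `I_c = (2/π²)∫₀^π∫₀^π sin²θ cos²ψ · c/(c² + 4 sin²θ sin²ψ) dψ dθ - 1/(2c)`, every `c > 0`.
[cite: OitmaaHamerZheng2006, §8.2.1 eq. (8.5)] -/
theorem integral_exp_neg_mul_besselJ01Sub_eq_integral {c : ℝ} (hc : 0 < c) :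
    ∫ ω in Ioi (0 : ℝ), Real.exp (-(c * ω)) * besselJ01Sub ω =
      2 / π ^ 2 * (∫ θ in (0 : ℝ)..π, ∫ ψ in (0 : ℝ)..π,
        Real.sin θ ^ 2 * Real.cos ψ ^ 2 * (c / (c ^ 2 + (2 * Real.sin θ * Real.sin ψ) ^ 2))) - 1 / (2 * c) := by
  have hhalf : IntegrableOn (fun ω : ℝ => Real.exp (-(c * ω)) * (1 / 2)) (Ioi 0) :=
    (integrable_exp_neg_Ioi' hc).mul_const _
  have hfull : IntegrableOn (fun ω : ℝ => Real.exp (-(c * ω)) * (besselJ 0 ω * besselJ 1 ω / ω)) (Ioi 0) := by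
    have h := (integrableOn_exp_neg_mul_besselJ01Sub hc).add hhalf
    refine h.congr_fun (fun ω _ => ?_) measurableSet_Ioi
    simp only [Pi.add_apply, besselJ01Sub]
    ring
  have hpt : ∀ ω ∈ Ioi (0 : ℝ), Real.exp (-(c * ω)) * besselJ01Sub ω =
      Real.exp (-(c * ω)) * (besselJ 0 ω * besselJ 1 ω / ω) - Real.exp (-(c * ω)) * (1 / 2) := by
    intro ω _; simp only [besselJ01Sub]; ring
  rw [setIntegral_congr_fun measurableSet_Ioi hpt, integral_sub hfull hhalf,
    integral_exp_neg_mul_besselJ_zero_mul_one_div_eq_integral hc, MeasureTheory.integral_mul_const]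
  have hexp : ∫ ω in Ioi (0 : ℝ), Real.exp (-(c * ω)) = 1 / c := by
    have h := integral_exp_mul_Ioi (a := -c) (by linarith) 0
    simp only [mul_zero, Real.exp_zero, neg_mul] at h
    rw [h]; field_simp
  rw [hexp]
  ring

/-! ## Centred moments `M_k` and the truncated expansion of `c/(c² + 4 sin²θ sin²ψ)` about `c² + 2` -/


/-- `(2/π²) 4^j W_{j+1} (W_j - W_{j+1}) = γ_j`. [cite: Watson1944, §5.43] -/
theorem besselJ01Moment_eq_wallis (j : ℕ) :
    2 / π ^ 2 * (4 ^ j * ((∫ x in (0 : ℝ)..π, Real.sin x ^ (2 * (j + 1))) * ((∫ x in (0 : ℝ)..π, Real.sin x ^ (2 * j)) - (∫ x in (0 : ℝ)..π, Real.sin x ^ (2 * (j + 1)))))) =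
      besselJ01Moment j := by
  have h := besselJ01Coeff_div_eq_wallis j
  have hf : ((2 * j)! : ℝ) ≠ 0 := by positivity
  have h2 : (2 : ℝ) ^ (2 * j + 1) ≠ 0 := by positivity
  have h4 : (4 : ℝ) ^ j = 2 ^ (2 * j) := by rw [pow_mul]; norm_num
  have hγ : besselJ01Moment j = besselJ01Coeff j / 2 ^ (2 * j + 1) * ((2 * j)! : ℝ) := by
    unfold besselJ01Moment; field_simp
  rw [hγ, ← h, h4]
  field_simp

/-- Inner power moment: `∫₀^π sin²θ cos²ψ ((2 sinθ sinψ)²)^j dψ = 4^j sin^{2j+2}θ (W_j - W_{j+1})`.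
[cite: Watson1944, §5.43] -/
theorem integral_sin_sq_mul_cos_sq_mul_pow (θ : ℝ) (j : ℕ) :
    ∫ ψ in (0 : ℝ)..π, Real.sin θ ^ 2 * Real.cos ψ ^ 2 * ((2 * Real.sin θ * Real.sin ψ) ^ 2) ^ j =
      4 ^ j * Real.sin θ ^ (2 * (j + 1)) * ((∫ x in (0 : ℝ)..π, Real.sin x ^ (2 * j)) - (∫ x in (0 : ℝ)..π, Real.sin x ^ (2 * (j + 1)))) := by
  rw [← integral_sin_pow_even_mul_cos_sq_eq_wallis, ← intervalIntegral.integral_const_mul]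
  refine intervalIntegral.integral_congr fun ψ _ => ?_
  have h4 : (4 : ℝ) ^ j = 2 ^ (2 * j) := by rw [pow_mul]; norm_num
  rw [h4, show 2 * (j + 1) = 2 * j + 2 by ring, pow_add, ← pow_mul]
  simp only [mul_pow]
  ring

/-- Double power moment: `∫₀^π∫₀^π sin²θ cos²ψ ((2 sinθ sinψ)²)^j dψ dθ = 4^j W_{j+1} (W_j - W_{j+1})`.
[cite: Watson1944, §5.43] -/
theorem integral_integral_sin_sq_mul_cos_sq_mul_pow (j : ℕ) :
    ∫ θ in (0 : ℝ)..π, ∫ ψ in (0 : ℝ)..π, Real.sin θ ^ 2 * Real.cos ψ ^ 2 * ((2 * Real.sin θ * Real.sin ψ) ^ 2) ^ j =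
      4 ^ j * ((∫ x in (0 : ℝ)..π, Real.sin x ^ (2 * (j + 1))) * ((∫ x in (0 : ℝ)..π, Real.sin x ^ (2 * j)) - (∫ x in (0 : ℝ)..π, Real.sin x ^ (2 * (j + 1))))) := by
  simp_rw [integral_sin_sq_mul_cos_sq_mul_pow]
  rw [intervalIntegral.integral_mul_const, intervalIntegral.integral_const_mul]
  ring

/-- **The centred moments as integrals**:
`(2/π²) ∫₀^π∫₀^π sin²θ cos²ψ ((2 sinθ sinψ)² - 2)^k dψ dθ = M_k` (binomial expansion, Wallis).
[cite: OitmaaHamerZheng2006, §8.2.1 eq. (8.6)] -/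
theorem integral_integral_pow_sub_two_eq_centredMoment (k : ℕ) :
    2 / π ^ 2 * ∫ θ in (0 : ℝ)..π, ∫ ψ in (0 : ℝ)..π,
        Real.sin θ ^ 2 * Real.cos ψ ^ 2 * ((2 * Real.sin θ * Real.sin ψ) ^ 2 - 2) ^ k =
      (∑ j ∈ Finset.range (k + 1), ((Nat.choose k j : ℕ) : ℝ) * (-2 : ℝ) ^ (k - j) * besselJ01Moment j) := by
  have hexp : ∀ θ ψ : ℝ, Real.sin θ ^ 2 * Real.cos ψ ^ 2 * ((2 * Real.sin θ * Real.sin ψ) ^ 2 - 2) ^ k =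
      ∑ j ∈ Finset.range (k + 1), ((k.choose j : ℕ) : ℝ) * (-2) ^ (k - j) *
        (Real.sin θ ^ 2 * Real.cos ψ ^ 2 * ((2 * Real.sin θ * Real.sin ψ) ^ 2) ^ j) := by
    intro θ ψ
    rw [sub_eq_add_neg, add_pow, Finset.mul_sum]
    refine Finset.sum_congr rfl fun j _ => ?_
    ring
  have hinner : ∀ θ : ℝ, ∫ ψ in (0 : ℝ)..π, Real.sin θ ^ 2 * Real.cos ψ ^ 2 * ((2 * Real.sin θ * Real.sin ψ) ^ 2 - 2) ^ k
      = ∑ j ∈ Finset.range (k + 1), ((k.choose j : ℕ) : ℝ) * (-2) ^ (k - j) *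
        (4 ^ j * Real.sin θ ^ (2 * (j + 1)) * ((∫ x in (0 : ℝ)..π, Real.sin x ^ (2 * j)) - (∫ x in (0 : ℝ)..π, Real.sin x ^ (2 * (j + 1))))) := by
    intro θ
    simp_rw [hexp]
    rw [intervalIntegral.integral_finsetSum (fun j _ => ?_)]
    · refine Finset.sum_congr rfl fun j _ => ?_
      rw [intervalIntegral.integral_const_mul, integral_sin_sq_mul_cos_sq_mul_pow]
    · exact (Continuous.intervalIntegrable (by fun_prop)) _ _
  simp_rw [hinner]
  rw [intervalIntegral.integral_finsetSum (fun j _ => (Continuous.intervalIntegrable (by fun_prop)) _ _)]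
  rw [Finset.mul_sum]
  refine Finset.sum_congr rfl fun j _ => ?_
  rw [← besselJ01Moment_eq_wallis j, intervalIntegral.integral_const_mul]
  have e : ∫ θ in (0 : ℝ)..π, 4 ^ j * Real.sin θ ^ (2 * (j + 1)) * ((∫ x in (0 : ℝ)..π, Real.sin x ^ (2 * j)) - (∫ x in (0 : ℝ)..π, Real.sin x ^ (2 * (j + 1)))) =
      4 ^ j * ((∫ x in (0 : ℝ)..π, Real.sin x ^ (2 * (j + 1))) * ((∫ x in (0 : ℝ)..π, Real.sin x ^ (2 * j)) - (∫ x in (0 : ℝ)..π, Real.sin x ^ (2 * (j + 1))))) := by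
    rw [intervalIntegral.integral_mul_const, intervalIntegral.integral_const_mul]
    ring
  rw [e]
  ring

/-- The finite geometric identity about `A = c² + 2`:
`c/(A + y) = c Σ_{k<K} (-y)^k/A^{k+1} + c (-y)^K/(A^K (A + y))` (`A + y ≠ 0`, `A ≠ 0`). [folklore] -/
private theorem div_add_eq_sum_add_remainder {A y : ℝ} (hA : A ≠ 0) (hAy : A + y ≠ 0) (c : ℝ) (K : ℕ) :
    c / (A + y) = c * ∑ k ∈ Finset.range K, (-y) ^ k / A ^ (k + 1) + c * (-y) ^ K / (A ^ K * (A + y)) := by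
  induction K with
  | zero => simp
  | succ K ih =>
    rw [Finset.sum_range_succ, mul_add, add_assoc]
    rw [ih]
    congr 1
    have hAK : A ^ K ≠ 0 := pow_ne_zero _ hA
    have hAK1 : A ^ (K + 1) ≠ 0 := pow_ne_zero _ hA
    field_simp
    ring

/-- **Truncated expansion with one-signed remainder.** For `c > 0`, `A = c² + 2` and EVEN `K`,
`0 ≤ ∫₀^∞ e^{-cω} J₀J₁/ω dω - c Σ_{k<K} (-1)^k M_k/A^{k+1} ≤ M_K/(c A^K)`:
the remainder `(2/π²)∫∫ sin²θcos²ψ · c y^K/(A^K (A+y))`, `y = (2 sinθ sinψ)² - 2`, has `0 ≤ y^K` and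
`A + y = c² + (2 sinθ sinψ)² ≥ c²`. The partial sums converge like `(2/A)^K`; for `c ≤ 2` this replaces
Takahashi's divergent `Σ (-1)^m γ_m/c^{2m+1}`. [cite: OitmaaHamerZheng2006, §8.2.1 eq. (8.5)] -/
theorem integral_exp_neg_mul_besselJ_zero_mul_one_div_mem_Icc {c : ℝ} (hc : 0 < c) {K : ℕ} (hK : Even K) :
    ∫ ω in Ioi (0 : ℝ), Real.exp (-(c * ω)) * (besselJ 0 ω * besselJ 1 ω / ω) ∈
      Set.Icc (c * ∑ k ∈ Finset.range K, (-1) ^ k * (∑ j ∈ Finset.range (k + 1), ((Nat.choose k j : ℕ) : ℝ) * (-2 : ℝ) ^ (k - j) * besselJ01Moment j) / (c ^ 2 + 2) ^ (k + 1))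
        (c * ∑ k ∈ Finset.range K, (-1) ^ k * (∑ j ∈ Finset.range (k + 1), ((Nat.choose k j : ℕ) : ℝ) * (-2 : ℝ) ^ (k - j) * besselJ01Moment j) / (c ^ 2 + 2) ^ (k + 1) +
          (∑ j ∈ Finset.range (K + 1), ((Nat.choose K j : ℕ) : ℝ) * (-2 : ℝ) ^ (K - j) * besselJ01Moment j) / (c * (c ^ 2 + 2) ^ K)) := by
  set A : ℝ := c ^ 2 + 2 with hA
  have hA0 : 0 < A := by positivity
  -- abbreviations for the weight and `y`
  set w : ℝ → ℝ → ℝ := fun θ ψ => Real.sin θ ^ 2 * Real.cos ψ ^ 2 with hw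
  set y : ℝ → ℝ → ℝ := fun θ ψ => (2 * Real.sin θ * Real.sin ψ) ^ 2 - 2 with hy
  have hw0 : ∀ θ ψ, 0 ≤ w θ ψ := fun θ ψ => by rw [hw]; positivity
  have hAy : ∀ θ ψ, c ^ 2 ≤ A + y θ ψ := fun θ ψ => by rw [hA, hy]; simp only; nlinarith [sq_nonneg (2 * Real.sin θ * Real.sin ψ)]
  have hAy0 : ∀ θ ψ, 0 < A + y θ ψ := fun θ ψ => lt_of_lt_of_le (by positivity) (hAy θ ψ)
  have hyK : ∀ θ ψ, 0 ≤ y θ ψ ^ K := fun θ ψ => hK.pow_nonneg _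
  -- the closed form
  have hL := integral_exp_neg_mul_besselJ_zero_mul_one_div_eq_integral hc
  have hcf : ∀ θ ψ, Real.sin θ ^ 2 * Real.cos ψ ^ 2 * (c / (c ^ 2 + (2 * Real.sin θ * Real.sin ψ) ^ 2)) =
      w θ ψ * (c / (A + y θ ψ)) := fun θ ψ => by rw [hw, hy, hA]; simp only; ring_nf
  simp_rw [hcf] at hL
  -- split pointwise
  have hsplit : ∀ θ ψ, w θ ψ * (c / (A + y θ ψ)) =
      (∑ k ∈ Finset.range K, c * ((-1) ^ k / A ^ (k + 1)) * (w θ ψ * y θ ψ ^ k)) +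
        w θ ψ * (c * y θ ψ ^ K / (A ^ K * (A + y θ ψ))) := by
    intro θ ψ
    rw [div_add_eq_sum_add_remainder hA0.ne' (hAy0 θ ψ).ne' c K, mul_add, Finset.mul_sum, Finset.mul_sum]
    congr 1
    · refine Finset.sum_congr rfl fun k _ => ?_
      rw [neg_pow]
      ring
    · rw [hK.neg_pow]
  -- integrability helpers (everything is continuous)
  have hcw : Continuous (Function.uncurry w) := by rw [hw]; fun_prop
  have hcy : Continuous (Function.uncurry y) := by rw [hy]; fun_prop
  have hcAy : Continuous fun p : ℝ × ℝ => A + y p.1 p.2 := continuous_const.add hcy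
  have hrem_cont : Continuous fun p : ℝ × ℝ => w p.1 p.2 * (c * y p.1 p.2 ^ K / (A ^ K * (A + y p.1 p.2))) := by
    refine hcw.mul ((continuous_const.mul (hcy.pow K)).div (continuous_const.mul hcAy) fun p => ?_)
    exact mul_ne_zero (pow_ne_zero _ hA0.ne') (hAy0 p.1 p.2).ne'
  have hterm_cont : ∀ k, Continuous fun p : ℝ × ℝ => c * ((-1) ^ k / A ^ (k + 1)) * (w p.1 p.2 * y p.1 p.2 ^ k) :=
    fun k => continuous_const.mul (hcw.mul (hcy.pow k))
  -- inner integrals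
  have hinner : ∀ θ, ∫ ψ in (0 : ℝ)..π, w θ ψ * (c / (A + y θ ψ)) =
      (∑ k ∈ Finset.range K, c * ((-1) ^ k / A ^ (k + 1)) * ∫ ψ in (0 : ℝ)..π, w θ ψ * y θ ψ ^ k) +
        ∫ ψ in (0 : ℝ)..π, w θ ψ * (c * y θ ψ ^ K / (A ^ K * (A + y θ ψ))) := by
    intro θ
    simp_rw [hsplit]
    rw [intervalIntegral.integral_add, intervalIntegral.integral_finsetSum]
    · simp_rw [intervalIntegral.integral_const_mul]
    · intro k _
      exact ((hterm_cont k).comp (Continuous.prodMk_right θ)).intervalIntegrable _ _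
    · exact (continuous_finsetSum _ fun k _ => (hterm_cont k).comp (Continuous.prodMk_right θ)).intervalIntegrable _ _
    · exact (hrem_cont.comp (Continuous.prodMk_right θ)).intervalIntegrable _ _
  have hIk : ∀ k, Continuous fun θ => ∫ ψ in (0 : ℝ)..π, w θ ψ * y θ ψ ^ k := fun k =>
    intervalIntegral.continuous_parametric_intervalIntegral_of_continuous' (hcw.mul (hcy.pow k)) 0 π
  have hIR : Continuous fun θ => ∫ ψ in (0 : ℝ)..π, w θ ψ * (c * y θ ψ ^ K / (A ^ K * (A + y θ ψ))) :=
    intervalIntegral.continuous_parametric_intervalIntegral_of_continuous' hrem_cont 0 π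
  have houter : ∫ θ in (0 : ℝ)..π, ∫ ψ in (0 : ℝ)..π, w θ ψ * (c / (A + y θ ψ)) =
      (∑ k ∈ Finset.range K, c * ((-1) ^ k / A ^ (k + 1)) *
          ∫ θ in (0 : ℝ)..π, ∫ ψ in (0 : ℝ)..π, w θ ψ * y θ ψ ^ k) +
        ∫ θ in (0 : ℝ)..π, ∫ ψ in (0 : ℝ)..π, w θ ψ * (c * y θ ψ ^ K / (A ^ K * (A + y θ ψ))) := by
    simp_rw [hinner]
    rw [intervalIntegral.integral_add, intervalIntegral.integral_finsetSum]
    · simp_rw [intervalIntegral.integral_const_mul]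
    · intro k _; exact (continuous_const.mul (hIk k)).intervalIntegrable _ _
    · exact (continuous_finsetSum _ fun k _ => continuous_const.mul (hIk k)).intervalIntegrable _ _
    · exact hIR.intervalIntegrable _ _
  -- the moments
  have hMk : ∀ k, 2 / π ^ 2 * ∫ θ in (0 : ℝ)..π, ∫ ψ in (0 : ℝ)..π, w θ ψ * y θ ψ ^ k = (∑ j ∈ Finset.range (k + 1), ((Nat.choose k j : ℕ) : ℝ) * (-2 : ℝ) ^ (k - j) * besselJ01Moment j) := by
    intro k
    rw [← integral_integral_pow_sub_two_eq_centredMoment k, hw, hy]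
  -- the remainder, bounded between `0` and `M_K/(c A^K)`
  set R : ℝ := ∫ θ in (0 : ℝ)..π, ∫ ψ in (0 : ℝ)..π, w θ ψ * (c * y θ ψ ^ K / (A ^ K * (A + y θ ψ))) with hR
  have hRlo : 0 ≤ R := by
    rw [hR]
    refine intervalIntegral.integral_nonneg Real.pi_pos.le fun θ _ => ?_
    refine intervalIntegral.integral_nonneg Real.pi_pos.le fun ψ _ => ?_
    exact mul_nonneg (hw0 θ ψ) (div_nonneg (mul_nonneg hc.le (hyK θ ψ)) (mul_nonneg (pow_nonneg hA0.le _) (hAy0 θ ψ).le))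
  have hRhi : R ≤ 1 / (c * A ^ K) * ∫ θ in (0 : ℝ)..π, ∫ ψ in (0 : ℝ)..π, w θ ψ * y θ ψ ^ K := by
    rw [hR, ← intervalIntegral.integral_const_mul]
    refine intervalIntegral.integral_mono_on Real.pi_pos.le (hIR.intervalIntegrable _ _)
      ((continuous_const.mul (hIk K)).intervalIntegrable _ _) fun θ _ => ?_
    rw [← intervalIntegral.integral_const_mul]
    refine intervalIntegral.integral_mono_on Real.pi_pos.le
      ((hrem_cont.comp (Continuous.prodMk_right θ)).intervalIntegrable _ _)
      ((continuous_const.mul ((hcw.mul (hcy.pow K)).comp (Continuous.prodMk_right θ))).intervalIntegrable _ _)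
      fun ψ _ => ?_
    -- pointwise: w * (c y^K/(A^K (A+y))) ≤ (1/(c A^K)) * (w * y^K)
    have h1 : c * y θ ψ ^ K / (A ^ K * (A + y θ ψ)) ≤ 1 / (c * A ^ K) * y θ ψ ^ K := by
      rw [div_le_iff₀ (mul_pos (pow_pos hA0 _) (hAy0 θ ψ))]
      have hAK : 0 < A ^ K := pow_pos hA0 _
      have e : 1 / (c * A ^ K) * y θ ψ ^ K * (A ^ K * (A + y θ ψ)) = y θ ψ ^ K * (A + y θ ψ) / c := by
        field_simp
      rw [e, le_div_iff₀ hc]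
      calc c * y θ ψ ^ K * c = y θ ψ ^ K * c ^ 2 := by ring
        _ ≤ y θ ψ ^ K * (A + y θ ψ) := mul_le_mul_of_nonneg_left (hAy θ ψ) (hyK θ ψ)
    calc w θ ψ * (c * y θ ψ ^ K / (A ^ K * (A + y θ ψ))) ≤ w θ ψ * (1 / (c * A ^ K) * y θ ψ ^ K) :=
          mul_le_mul_of_nonneg_left h1 (hw0 θ ψ)
      _ = 1 / (c * A ^ K) * (w θ ψ * y θ ψ ^ K) := by ring
  -- assemble
  have hmain : ∫ ω in Ioi (0 : ℝ), Real.exp (-(c * ω)) * (besselJ 0 ω * besselJ 1 ω / ω) =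
      c * ∑ k ∈ Finset.range K, (-1) ^ k * (∑ j ∈ Finset.range (k + 1), ((Nat.choose k j : ℕ) : ℝ) * (-2 : ℝ) ^ (k - j) * besselJ01Moment j) / A ^ (k + 1) + 2 / π ^ 2 * R := by
    rw [hL, houter, mul_add, Finset.mul_sum, Finset.mul_sum]
    congr 1
    refine Finset.sum_congr rfl fun k _ => ?_
    rw [← hMk k]
    ring
  have hπ : 0 < 2 / π ^ 2 := by positivity
  have hRhi' : 2 / π ^ 2 * R ≤ (∑ j ∈ Finset.range (K + 1), ((Nat.choose K j : ℕ) : ℝ) * (-2 : ℝ) ^ (K - j) * besselJ01Moment j) / (c * A ^ K) := by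
    rw [← hMk K]
    calc 2 / π ^ 2 * R ≤ 2 / π ^ 2 * (1 / (c * A ^ K) * ∫ θ in (0 : ℝ)..π, ∫ ψ in (0 : ℝ)..π, w θ ψ * y θ ψ ^ K) := by
          gcongr
      _ = _ := by ring
  rw [hmain]
  constructor
  · linarith [mul_nonneg hπ.le hRlo]
  · linarith

/-! ## Kernel-checked values of the Laplace terms inside and on the circle: `c = 1`, `3/2`, `2`

The finite double sums `Σ_{k<K} (-1)^k M_k/A^{k+1}`, `M_k = Σ_j C(k,j)(-2)^{k-j} γ_j`, are evaluated by `norm_num` from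
the tabulated `γ_0, …, γ_48` (`LiebWuEnergyHalfFillingEnclosure{,Table}`, `LiebWuDoubleOccupancyEnclosure`). -/

/-- `I_c = ∫₀^∞ e^{-cω} g = (∫₀^∞ e^{-cω} J₀J₁/ω) - 1/(2c)` for `c > 0`. [cite: OitmaaHamerZheng2006, §8.2.1 eq. (8.5)] -/
theorem integral_exp_neg_mul_besselJ01Sub_eq_sub {c : ℝ} (hc : 0 < c) :
    ∫ ω in Ioi (0 : ℝ), Real.exp (-(c * ω)) * besselJ01Sub ω =
      (∫ ω in Ioi (0 : ℝ), Real.exp (-(c * ω)) * (besselJ 0 ω * besselJ 1 ω / ω)) - 1 / (2 * c) := by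
  rw [integral_exp_neg_mul_besselJ01Sub_eq_integral hc, integral_exp_neg_mul_besselJ_zero_mul_one_div_eq_integral hc]

/-- **`I_1 = ∫₀^∞ e^{-ω} (J₀J₁/ω - 1/2) dω ∈ [-0.161195014319, -0.161195014064]`** (width `2.6e-10`; `K = 48` terms
of the expansion about `c² + 2 = 3`, remainder `M_48/3^48 ≤ 2.55e-10`). The Laplace term at `c = 1` — INSIDE the
circle `c = 2` — is the `n = 1` term of Step 2 for `e_LW(2)`. [cite: OitmaaHamerZheng2006, §8.2.1 eq. (8.5)] -/
theorem integral_exp_neg_one_mul_besselJ01Sub_mem_Icc :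
    ∫ ω in Ioi (0 : ℝ), Real.exp (-(1 * ω)) * besselJ01Sub ω ∈
      Set.Icc (-0.161195014319 : ℝ) (-0.161195014064) := by
  have h := integral_exp_neg_mul_besselJ_zero_mul_one_div_mem_Icc one_pos (K := 48) (by decide)
  rw [integral_exp_neg_mul_besselJ01Sub_eq_sub one_pos]
  set_option maxHeartbeats 8000000 in
  simp only [sum_range_succ, sum_range_zero, besselJ01Moment_zero, besselJ01Moment_one, besselJ01Moment_two, besselJ01Moment_three, besselJ01Moment_four, besselJ01Moment_five, besselJ01Moment_six, besselJ01Moment_seven, besselJ01Moment_eight, besselJ01Moment_nine, besselJ01Moment_ten, besselJ01Moment_eleven, besselJ01Moment_twelve, besselJ01Moment_13, besselJ01Moment_14, besselJ01Moment_15, besselJ01Moment_16, besselJ01Moment_17, besselJ01Moment_18, besselJ01Moment_19, besselJ01Moment_20, besselJ01Moment_21, besselJ01Moment_22, besselJ01Moment_23, besselJ01Moment_24, besselJ01Moment_25, besselJ01Moment_26, besselJ01Moment_27, besselJ01Moment_28, besselJ01Moment_29, besselJ01Moment_30, besselJ01Moment_31, besselJ01Moment_32, besselJ01Moment_33, besselJ01Moment_34,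 besselJ01Moment_35, besselJ01Moment_36, besselJ01Moment_37, besselJ01Moment_38, besselJ01Moment_39, besselJ01Moment_40, besselJ01Moment_41, besselJ01Moment_42, besselJ01Moment_43, besselJ01Moment_44, besselJ01Moment_45, besselJ01Moment_46, besselJ01Moment_47, besselJ01Moment_48] at h
  set_option maxHeartbeats 8000000 in
  norm_num [Nat.choose_eq_factorial_div_factorial, Nat.factorial] at h ⊢
  constructor <;> linarith [h.1, h.2]

/-- **`I_{3/2} = ∫₀^∞ e^{-3ω/2} (J₀J₁/ω - 1/2) dω ∈ [-0.06764632049, -0.06764632048]`** (width `1e-11`; `K = 30`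
terms about `c² + 2 = 17/4`, remainder `M_30/((3/2)(17/4)^30) ≤ 9.1e-12`). The Laplace term at `c = 3/2`, the
`n = 1` term of Step 2 for `e_LW(3)`. [cite: OitmaaHamerZheng2006, §8.2.1 eq. (8.5)] -/
theorem integral_exp_neg_three_halves_mul_besselJ01Sub_mem_Icc :
    ∫ ω in Ioi (0 : ℝ), Real.exp (-(3 / 2 * ω)) * besselJ01Sub ω ∈
      Set.Icc (-0.06764632049 : ℝ) (-0.06764632048) := by
  have h := integral_exp_neg_mul_besselJ_zero_mul_one_div_mem_Icc (by norm_num : (0 : ℝ) < 3 / 2) (K := 30)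
    (by decide)
  rw [integral_exp_neg_mul_besselJ01Sub_eq_sub (by norm_num : (0 : ℝ) < 3 / 2)]
  set_option maxHeartbeats 8000000 in
  simp only [sum_range_succ, sum_range_zero, besselJ01Moment_zero, besselJ01Moment_one, besselJ01Moment_two, besselJ01Moment_three, besselJ01Moment_four, besselJ01Moment_five, besselJ01Moment_six, besselJ01Moment_seven, besselJ01Moment_eight, besselJ01Moment_nine, besselJ01Moment_ten, besselJ01Moment_eleven, besselJ01Moment_twelve, besselJ01Moment_13, besselJ01Moment_14, besselJ01Moment_15, besselJ01Moment_16, besselJ01Moment_17, besselJ01Moment_18, besselJ01Moment_19, besselJ01Moment_20, besselJ01Moment_21, besselJ01Moment_22, besselJ01Moment_23, besselJ01Moment_24, besselJ01Moment_25, besselJ01Moment_26, besselJ01Moment_27, besselJ01Moment_28, besselJ01Moment_29, besselJ01Moment_30] at h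
  set_option maxHeartbeats 8000000 in
  norm_num [Nat.choose_eq_factorial_div_factorial, Nat.factorial] at h ⊢
  constructor <;> linarith [h.1, h.2]

/-- **`I_2 = ∫₀^∞ e^{-2ω} (J₀J₁/ω - 1/2) dω ∈ [-0.0339932765751, -0.033993276575]`** (width `1e-13`; `K = 26` terms
about `c² + 2 = 6`, remainder `M_26/(2·6^26) ≤ 1.9e-14`). The Laplace term ON the circle `c = 2` (`n = 1` term of
`e_LW(4)`, `n = 2` term of `e_LW(2)`); `LiebWuEnergyHalfFillingEnclosureU4.integral_exp_neg_two_mul_besselJ01Sub_mem_Icc`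
encloses the same number to `3.1e-9` by fourth-order convexity of its boundary series.
[cite: OitmaaHamerZheng2006, §8.2.1 eq. (8.5)] -/
theorem integral_exp_neg_two_mul_besselJ01Sub_mem_Icc' :
    ∫ ω in Ioi (0 : ℝ), Real.exp (-(2 * ω)) * besselJ01Sub ω ∈
      Set.Icc (-0.0339932765751 : ℝ) (-0.033993276575) := by
  have h := integral_exp_neg_mul_besselJ_zero_mul_one_div_mem_Icc (by norm_num : (0 : ℝ) < 2) (K := 26)
    (by decide)
  rw [integral_exp_neg_mul_besselJ01Sub_eq_sub (by norm_num : (0 : ℝ) < 2)]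
  set_option maxHeartbeats 8000000 in
  simp only [sum_range_succ, sum_range_zero, besselJ01Moment_zero, besselJ01Moment_one, besselJ01Moment_two, besselJ01Moment_three, besselJ01Moment_four, besselJ01Moment_five, besselJ01Moment_six, besselJ01Moment_seven, besselJ01Moment_eight, besselJ01Moment_nine, besselJ01Moment_ten, besselJ01Moment_eleven, besselJ01Moment_twelve, besselJ01Moment_13, besselJ01Moment_14, besselJ01Moment_15, besselJ01Moment_16, besselJ01Moment_17, besselJ01Moment_18, besselJ01Moment_19, besselJ01Moment_20, besselJ01Moment_21, besselJ01Moment_22, besselJ01Moment_23, besselJ01Moment_24, besselJ01Moment_25, besselJ01Moment_26] at h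
  set_option maxHeartbeats 8000000 in
  norm_num [Nat.choose_eq_factorial_div_factorial, Nat.factorial] at h ⊢
  constructor <;> linarith [h.1, h.2]

end Literature.Analysis.FunctionSpaces
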